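import Literature.NumberTheory.Sieve.HeathBrownCubicSigmaOne
import Literature.NumberTheory.Sieve.HeathBrownMorozResidueClassesSieve
import HarnessLib

/-!
# The coprime-restricted singular sum `Σ₁^{(d)}`, I: coefficients and local factors (stub S3 `stub_sigmaOneCoprime`, line `parent-differencing`, crux `HeathBrownMorozUniform`, stmt-Parity-19915)

Helper file (`--supports stmt-Parity-19915`) for the crux
`Summit.Parity.GeneralizedHardyLittlewood.Theses.GoldbachHeathBrownDispersion.HeathBrownMorozUniform`
(Heath-Brown–Moroz 2004, Theorem 2 for `x³ + 2y³`: primes of Heath-Brown's sequence in admissible residue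
classes).  **Nothing here bears on Goldbach**: this is one arithmetic input of ONE line of attack on ONE crux of a
FRONTIER formalisation rung (a 2004 theorem).

The target (proved in the sequel `…HeathBrownMorozUniformSigmaOneCoprime`, theorem `classSigmaOneCoprime`, literally
the registered stub signature `ClassSigmaOneCoprime` of `Cruxes/HeathBrownMorozUniform/Lines/parent_differencing.lean`):
for `d ≥ 1` and `σ₀` the limit of the ordered partial products `singularProductPartial` of Heath-Brown's singular
series, `∑_{N(J) ≤ x, N(J) □-free, (d, N(J)) = 1} μ(J) log(x/N(J)) ρ₂(J)/N(J) = (π²/6)σ₀·coprimeClassWeight d +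
O_d(e^{−c√(log x)})` — the sum `Σ₆` of [HeathBrownMoroz2004] p. 20 ("as in [3, p. 62]"), i.e. Heath-Brown's `Σ₁`
of [HeathBrownActa2001] §10 pp. 62–63 (tree: `CubicSieve.HeathBrown2001_sigmaOne_bound`, the case `d = 1`) with the
extra condition `(N(J), d) = 1`.  The proof is the tree's proof of the case `d = 1` (`HeathBrownCubicSigmaOne`)
twisted by the finite Euler factor `∏_{p∣d}(1 − ρ₀(p)p^{-s})^{-1}`.

This file declares NO definitions: every lemma is stated for an arithmetic function `a` with
`ha : ∀ n, a n = [(d,n)=1]·a(n)` (`a(q) = μ(q)∏_{p∣q}ρ₀(p)` = `CubicSieve.sigmaOneCoeff`; such an `a` exists,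
`exists_sigmaOneCoeffCop`), with `h_d := a * normCountAF` (`= a_d ⋆ c_K`), `F_d(n) := |h_d(n)| n^{-3/4}` and
`h_d(n)/n` written out.

* §A `a_d` and `h_d = a_d ⋆ c_K` (multiplicative; `h_d(p^e) = h(p^e)` for `p ∤ d`, `h_d(p^e) = c_K(p^e)` for `p ∣ d`;
  `|h_d(p^e)| ≤ 4(e+1)³`);
* §B `F_d(n) = |h_d(n)| n^{-3/4}` and its local factors: the tree's `∑_e F(p^e) ≤ 1 + (3 + T₀)p^{-3/2}` at `p ∤ d`,
  `≤ T₀ = ∑_e 4(e+3)³(3/4)^e` at `p ∣ d`; the constant `M_d = (1 + T₀)^{ω(d)} B_h > 0`;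
* §C `h_d(n)/n` and the local factors of `L(h_d, ·)` at `1`: the tree's `(1 − ρ₀(p)/p)(1 − normDensityAt p)⁻¹` at
  `p ∤ d`, `(1 − normDensityAt p)⁻¹` at `p ∣ d`; hence `∏_{p<N}` of them is `V_𝒜(N)/V_ℬ(N) · E_N(d)` with
  `E_N(d) = ∏_{p<N, p∣d}(1 − ν_p/(p+1))⁻¹ = coprimeClassWeight d` for `N > d`.

References: [cite: HeathBrownActa2001, §10 pp. 62–63]; [cite: HeathBrownMoroz2004, Lemma 4.1 (p. 20) and (3.1)].
Tree: `HeathBrownCubicSigmaOne` (`sigmaOneCoeff`, `sigmaOneNum`, `sigmaOneF`, `sigmaOneQuot`, `rpow_neg34_facts`,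
`summable_four_mul_cube_mul_geometric`, `tsum_sigmaOneF_prime_pow_le`, `tsum_sigmaOneQuot_prime_pow`,
`prod_tsum_sigmaOneQuot_eq`, `hasSum_idealNormCount_prime_pow_div'`, `sigmaOneNormBound`, `sigmaOneTailConst`),
`HeathBrownMorozResidueClassesSieve` (`coprimeClassWeight`, `inv_one_sub_densA_eq`, `one_sub_densA_pos_le`),
`IdealNormCount` (`idealNormCount_prime_pow_le`), Mathlib `Nat.divisors_prime_pow`, `Nat.sum_divisorsAntidiagonal`,
`Nat.coprime_mul_iff_right`, `Nat.coprime_pow_right_iff`.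
-/

noncomputable section

open NumberField Finset Filter Topology
open scoped ArithmeticFunction.Moebius

namespace Summit.Parity.GeneralizedHardyLittlewood.Theorems.GoldbachHeathBrownDispersionHeathBrownMorozUniform

open Literature.NumberTheory
open Literature.NumberTheory.Sieve.CubicSieve Literature.NumberTheory.Sieve.CubicPrimes
open Literature.NumberTheory.LFunctions.CubeRootTwoField
open Literature.NumberTheory.LFunctions (idealNormCount)

/-! ### A. The coefficients `a_d = a·[(d,·)=1]` and `h_d = a_d ⋆ c_K`

No definitions are declared: every lemma is stated for an arithmetic function `a` satisfying
`ha : ∀ n, a n = [(d,n)=1]·a(n)` (`a(q) = μ(q)∏_{p∣q}ρ₀(p)` = `CubicSieve.sigmaOneCoeff`); such an `a` exists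
(`exists_sigmaOneCoeffCop`), `h_d` is `a * normCountAF`, `F_d(n)` is `|h_d(n)| n^{-3/4}`, `h_d(n)/n` is written out. -/

/-- **The coefficients `a_d` exist**: there is an arithmetic function with `a_d(n) = a(n)` if `(d, n) = 1` and
`a_d(n) = 0` otherwise (the coefficients of `f_d(s) = ∑_{(q,d)=1}ρ₀(q)μ(q)q^{-s}`).
[cite: HeathBrownMoroz2004, Lemma 4.1 (p. 20)] -/
theorem exists_sigmaOneCoeffCop (d : ℕ) :
    ∃ a : ArithmeticFunction ℝ, ∀ n, a n = if Nat.Coprime d n then sigmaOneCoeff n else 0 :=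
  ⟨⟨fun n => if Nat.Coprime d n then sigmaOneCoeff n else 0, by simp⟩, fun _ => rfl⟩

/-- `a_d` is multiplicative. [folklore] -/
theorem isMultiplicative_sigmaOneCoeffCop {d : ℕ} {a : ArithmeticFunction ℝ}
    (ha : ∀ n, a n = if Nat.Coprime d n then sigmaOneCoeff n else 0) : a.IsMultiplicative := by
  refine ⟨?_, fun {m n} hmn => ?_⟩
  · rw [ha, if_pos (Nat.coprime_one_right d), isMultiplicative_sigmaOneCoeff.map_one]
  · rw [ha (m * n), ha m, ha n]
    by_cases hm : Nat.Coprime d m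
    · by_cases hn : Nat.Coprime d n
      · rw [if_pos (Nat.coprime_mul_iff_right.2 ⟨hm, hn⟩), if_pos hm, if_pos hn,
          isMultiplicative_sigmaOneCoeff.map_mul_of_coprime hmn]
      · have : ¬Nat.Coprime d (m * n) := fun h => hn (Nat.coprime_mul_iff_right.1 h).2
        rw [if_neg this, if_neg hn, mul_zero]
    · have : ¬Nat.Coprime d (m * n) := fun h => hm (Nat.coprime_mul_iff_right.1 h).1
      rw [if_neg this, if_neg hm, zero_mul]

/-- `|a_d(n)| ≤ c_K(n)`. [folklore] -/
theorem abs_sigmaOneCoeffCop_le {d : ℕ} {a : ArithmeticFunction ℝ}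
    (ha : ∀ n, a n = if Nat.Coprime d n then sigmaOneCoeff n else 0) (n : ℕ) : |a n| ≤ normCountAF n := by
  rw [ha]
  split_ifs
  · exact abs_sigmaOneCoeff_le n
  · rw [abs_zero]; exact normCountAF_nonneg n

/-- `a_d(p^e) = a(p^e)` for `p ∤ d`. [folklore] -/
theorem sigmaOneCoeffCop_prime_pow_of_not_dvd {d : ℕ} {a : ArithmeticFunction ℝ}
    (ha : ∀ n, a n = if Nat.Coprime d n then sigmaOneCoeff n else 0) {p : ℕ} (hp : p.Prime) (hpd : ¬p ∣ d)
    (e : ℕ) : a (p ^ e) = sigmaOneCoeff (p ^ e) := by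
  rw [ha, if_pos]
  exact Nat.Coprime.pow_right e ((Nat.Prime.coprime_iff_not_dvd hp).2 hpd).symm

/-- `a_d(p^e) = 0` for `p ∣ d`, `e ≥ 1`. [folklore] -/
theorem sigmaOneCoeffCop_prime_pow_of_dvd {d : ℕ} {a : ArithmeticFunction ℝ}
    (ha : ∀ n, a n = if Nat.Coprime d n then sigmaOneCoeff n else 0) {p : ℕ} (hp : p.Prime) (hpd : p ∣ d)
    {e : ℕ} (he : e ≠ 0) : a (p ^ e) = 0 := by
  rw [ha, if_neg]
  intro h
  have : Nat.Coprime d p := (Nat.coprime_pow_right_iff (Nat.pos_of_ne_zero he) _ _).1 h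
  exact (Nat.Prime.coprime_iff_not_dvd hp).1 this.symm hpd

/-- `h_d = a_d ⋆ c_K` is multiplicative. [folklore] -/
theorem isMultiplicative_sigmaOneNumCop {d : ℕ} {a : ArithmeticFunction ℝ}
    (ha : ∀ n, a n = if Nat.Coprime d n then sigmaOneCoeff n else 0) : (a * normCountAF).IsMultiplicative :=
  (isMultiplicative_sigmaOneCoeffCop ha).mul isMultiplicative_normCountAF

/-- `h_d(1) = 1`. [folklore] -/
theorem sigmaOneNumCop_one {d : ℕ} {a : ArithmeticFunction ℝ}
    (ha : ∀ n, a n = if Nat.Coprime d n then sigmaOneCoeff n else 0) : (a * normCountAF) 1 = 1 :=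
  (isMultiplicative_sigmaOneNumCop ha).map_one

/-- `h_d(p^e) = h(p^e)` for `p ∤ d` (every divisor of `p^e` is a power of `p`, coprime to `d`). [folklore] -/
theorem sigmaOneNumCop_prime_pow_of_not_dvd {d : ℕ} {a : ArithmeticFunction ℝ}
    (ha : ∀ n, a n = if Nat.Coprime d n then sigmaOneCoeff n else 0) {p : ℕ} (hp : p.Prime) (hpd : ¬p ∣ d)
    (e : ℕ) : (a * normCountAF) (p ^ e) = sigmaOneNum (p ^ e) := by
  rw [sigmaOneNum, ArithmeticFunction.mul_apply, ArithmeticFunction.mul_apply]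
  refine Finset.sum_congr rfl fun x hx => ?_
  have hx1 : x.1 ∣ p ^ e := Dvd.intro _ (Nat.mem_divisorsAntidiagonal.1 hx).1
  obtain ⟨i, -, hi⟩ := (Nat.dvd_prime_pow hp).1 hx1
  rw [hi, sigmaOneCoeffCop_prime_pow_of_not_dvd ha hp hpd]

/-- `h_d(p^e) = c_K(p^e)` for `p ∣ d` (only the divisor `1` of `p^e` is a `d`-unit). [folklore] -/
theorem sigmaOneNumCop_prime_pow_of_dvd {d : ℕ} {a : ArithmeticFunction ℝ}
    (ha : ∀ n, a n = if Nat.Coprime d n then sigmaOneCoeff n else 0) {p : ℕ} (hp : p.Prime) (hpd : p ∣ d)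
    (e : ℕ) : (a * normCountAF) (p ^ e) = idealNormCount K (p ^ e) := by
  rw [ArithmeticFunction.mul_apply, Nat.sum_divisorsAntidiagonal (fun i j => a i * normCountAF j),
    Nat.divisors_prime_pow hp, Finset.sum_map, Finset.sum_eq_single 0]
  · simp only [Function.Embedding.coeFn_mk, pow_zero, Nat.div_one]
    rw [(isMultiplicative_sigmaOneCoeffCop ha).map_one, one_mul,
      normCountAF_apply (pow_ne_zero _ hp.ne_zero)]
  · intro i _ hi
    simp only [Function.Embedding.coeFn_mk]
    rw [sigmaOneCoeffCop_prime_pow_of_dvd ha hp hpd hi, zero_mul]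
  · intro h
    exact absurd (Finset.mem_range.2 (Nat.succ_pos e)) h

/-- `|h_d(p^e)| ≤ 4(e+1)³` (`c_K(p^e) ≤ (e+1)³` at `p ∣ d`; the tree's bound at `p ∤ d`). [folklore] -/
theorem abs_sigmaOneNumCop_prime_pow_le {d : ℕ} {a : ArithmeticFunction ℝ}
    (ha : ∀ n, a n = if Nat.Coprime d n then sigmaOneCoeff n else 0) {p : ℕ} (hp : p.Prime) (e : ℕ) :
    |(a * normCountAF) (p ^ e)| ≤ 4 * ((e : ℝ) + 1) ^ 3 := by
  by_cases hpd : p ∣ d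
  · rw [sigmaOneNumCop_prime_pow_of_dvd ha hp hpd, Nat.abs_cast]
    have h1 := LFunctions.idealNormCount_prime_pow_le K p e hp
    rw [finrank_K] at h1
    have h0 : (0 : ℝ) ≤ ((e : ℝ) + 1) ^ 3 := by positivity
    linarith
  · rw [sigmaOneNumCop_prime_pow_of_not_dvd ha hp hpd]
    exact abs_sigmaOneNum_prime_pow_le hp e

/-! ### B. `F_d(n) = |h_d(n)| n^{-3/4}`: local factors -/

/-- `F_d ≥ 0`. [folklore] -/
theorem sigmaOneFCop_nonneg (a : ArithmeticFunction ℝ) (n : ℕ) :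
    0 ≤ |(a * normCountAF) n| * ((n : ℕ) : ℝ) ^ (-(3 / 4 : ℝ)) :=
  mul_nonneg (abs_nonneg _) (Real.rpow_nonneg (Nat.cast_nonneg _) _)

/-- `F_d(0) = 0`. [folklore] -/
theorem sigmaOneFCop_zero (a : ArithmeticFunction ℝ) :
    |(a * normCountAF) 0| * ((0 : ℕ) : ℝ) ^ (-(3 / 4 : ℝ)) = 0 := by simp

/-- `F_d(1) = 1`. [folklore] -/
theorem sigmaOneFCop_one {d : ℕ} {a : ArithmeticFunction ℝ}
    (ha : ∀ n, a n = if Nat.Coprime d n then sigmaOneCoeff n else 0) :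
    |(a * normCountAF) 1| * ((1 : ℕ) : ℝ) ^ (-(3 / 4 : ℝ)) = 1 := by
  rw [sigmaOneNumCop_one ha, abs_one, one_mul, Nat.cast_one, Real.one_rpow]

/-- `F_d` is multiplicative on coprime arguments. [folklore] -/
theorem sigmaOneFCop_mul_of_coprime {d : ℕ} {a : ArithmeticFunction ℝ}
    (ha : ∀ n, a n = if Nat.Coprime d n then sigmaOneCoeff n else 0) {m n : ℕ} (h : m.Coprime n) :
    |(a * normCountAF) (m * n)| * ((m * n : ℕ) : ℝ) ^ (-(3 / 4 : ℝ)) =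
      |(a * normCountAF) m| * ((m : ℕ) : ℝ) ^ (-(3 / 4 : ℝ)) *
        (|(a * normCountAF) n| * ((n : ℕ) : ℝ) ^ (-(3 / 4 : ℝ))) := by
  rw [(isMultiplicative_sigmaOneNumCop ha).map_mul_of_coprime h, abs_mul, Nat.cast_mul,
    Real.mul_rpow (Nat.cast_nonneg _) (Nat.cast_nonneg _)]
  ring

/-- `F_d(p^e) = |h_d(p^e)| r_p^e`, `r_p = p^{-3/4}`. [folklore] -/
theorem sigmaOneFCop_prime_pow (a : ArithmeticFunction ℝ) (p e : ℕ) :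
    |(a * normCountAF) (p ^ e)| * ((p ^ e : ℕ) : ℝ) ^ (-(3 / 4 : ℝ)) =
      |(a * normCountAF) (p ^ e)| * ((p : ℝ) ^ (-(3 / 4 : ℝ))) ^ e := by
  rw [Nat.cast_pow, Real.rpow_pow_comm (Nat.cast_nonneg _)]

/-- `F_d(p^e) = F(p^e)` for `p ∤ d`. [folklore] -/
theorem sigmaOneFCop_prime_pow_of_not_dvd {d : ℕ} {a : ArithmeticFunction ℝ}
    (ha : ∀ n, a n = if Nat.Coprime d n then sigmaOneCoeff n else 0) {p : ℕ} (hp : p.Prime) (hpd : ¬p ∣ d)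
    (e : ℕ) : |(a * normCountAF) (p ^ e)| * ((p ^ e : ℕ) : ℝ) ^ (-(3 / 4 : ℝ)) = sigmaOneF (p ^ e) := by
  rw [sigmaOneFCop_prime_pow, sigmaOneF_prime_pow, sigmaOneNumCop_prime_pow_of_not_dvd ha hp hpd]

/-- `F_d(p^e) ≤ 4(e+3)³ r_p^e`, the dominating polynomial-geometric term. [folklore] -/
theorem sigmaOneFCop_prime_pow_le {d : ℕ} {a : ArithmeticFunction ℝ}
    (ha : ∀ n, a n = if Nat.Coprime d n then sigmaOneCoeff n else 0) {p : ℕ} (hp : p.Prime) (e : ℕ) :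
    |(a * normCountAF) (p ^ e)| * ((p ^ e : ℕ) : ℝ) ^ (-(3 / 4 : ℝ)) ≤
      4 * ((e : ℝ) + 3) ^ 3 * ((p : ℝ) ^ (-(3 / 4 : ℝ))) ^ e := by
  obtain ⟨hr0, -, -, -⟩ := rpow_neg34_facts hp
  rw [sigmaOneFCop_prime_pow]
  have h1 := abs_sigmaOneNumCop_prime_pow_le ha hp e
  have he : 4 * ((e : ℝ) + 1) ^ 3 ≤ 4 * ((e : ℝ) + 3) ^ 3 := by
    gcongr; linarith
  calc |(a * normCountAF) (p ^ e)| * ((p : ℝ) ^ (-(3 / 4 : ℝ))) ^ e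
      ≤ 4 * ((e : ℝ) + 1) ^ 3 * ((p : ℝ) ^ (-(3 / 4 : ℝ))) ^ e :=
        mul_le_mul_of_nonneg_right h1 (pow_nonneg hr0.le _)
    _ ≤ _ := mul_le_mul_of_nonneg_right he (pow_nonneg hr0.le _)

/-- Local summability: `∑_e F_d(p^e)` converges. [folklore] -/
theorem summable_sigmaOneFCop_prime_pow {d : ℕ} {a : ArithmeticFunction ℝ}
    (ha : ∀ n, a n = if Nat.Coprime d n then sigmaOneCoeff n else 0) {p : ℕ} (hp : p.Prime) :
    Summable fun e : ℕ => |(a * normCountAF) (p ^ e)| * ((p ^ e : ℕ) : ℝ) ^ (-(3 / 4 : ℝ)) := by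
  obtain ⟨hr0, hr34, -, -⟩ := rpow_neg34_facts hp
  have hr1 : (p : ℝ) ^ (-(3 / 4 : ℝ)) < 1 := by linarith
  exact Summable.of_nonneg_of_le (fun e => sigmaOneFCop_nonneg _ _)
    (fun e => sigmaOneFCop_prime_pow_le ha hp e) (summable_four_mul_cube_mul_geometric hr0 hr1)

/-- The local factor at any prime (used at `p ∣ d`): `∑_e F_d(p^e) ≤ T₀ = ∑_e 4(e+3)³(3/4)^e`. [folklore] -/
theorem tsum_sigmaOneFCop_prime_pow_le {d : ℕ} {a : ArithmeticFunction ℝ}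
    (ha : ∀ n, a n = if Nat.Coprime d n then sigmaOneCoeff n else 0) {p : ℕ} (hp : p.Prime) :
    ∑' e : ℕ, |(a * normCountAF) (p ^ e)| * ((p ^ e : ℕ) : ℝ) ^ (-(3 / 4 : ℝ)) ≤ sigmaOneTailConst := by
  obtain ⟨hr0, hr34, -, -⟩ := rpow_neg34_facts hp
  have hgeo := summable_four_mul_cube_mul_geometric (by norm_num : (0 : ℝ) < 3 / 4) (by norm_num)
  rw [sigmaOneTailConst]
  refine Summable.tsum_le_tsum (fun e => ?_) (summable_sigmaOneFCop_prime_pow ha hp) hgeo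
  have hre : ((p : ℝ) ^ (-(3 / 4 : ℝ))) ^ e ≤ (3 / 4 : ℝ) ^ e := pow_le_pow_left₀ hr0.le hr34 e
  calc |(a * normCountAF) (p ^ e)| * ((p ^ e : ℕ) : ℝ) ^ (-(3 / 4 : ℝ))
      ≤ 4 * ((e : ℝ) + 3) ^ 3 * ((p : ℝ) ^ (-(3 / 4 : ℝ))) ^ e := sigmaOneFCop_prime_pow_le ha hp e
    _ ≤ 4 * ((e : ℝ) + 3) ^ 3 * (3 / 4 : ℝ) ^ e := by gcongr

/-- The local factor at a prime `p ∤ d` is the tree's: `∑_e F_d(p^e) ≤ 1 + (3 + T₀)p^{-3/2}`. [folklore] -/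
theorem tsum_sigmaOneFCop_prime_pow_le_of_not_dvd {d : ℕ} {a : ArithmeticFunction ℝ}
    (ha : ∀ n, a n = if Nat.Coprime d n then sigmaOneCoeff n else 0) {p : ℕ} (hp : p.Prime) (hpd : ¬p ∣ d) :
    ∑' e : ℕ, |(a * normCountAF) (p ^ e)| * ((p ^ e : ℕ) : ℝ) ^ (-(3 / 4 : ℝ)) ≤
      1 + (3 + sigmaOneTailConst) * (p : ℝ) ^ (-(3 / 2 : ℝ)) := by
  rw [tsum_congr fun e => sigmaOneFCop_prime_pow_of_not_dvd ha hp hpd e]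
  exact tsum_sigmaOneF_prime_pow_le hp

/-- For `0 < d < N`, the primes below `N` dividing `d` are the prime factors of `d`. [folklore] -/
theorem primesBelow_filter_dvd_eq {d N : ℕ} (hd : d ≠ 0) (hN : d < N) :
    (Nat.primesBelow N).filter (· ∣ d) = d.primeFactors := by
  ext p
  rw [mem_filter, Nat.mem_primesBelow, Nat.mem_primeFactors]
  constructor
  · rintro ⟨⟨-, hp⟩, hpd⟩; exact ⟨hp, hpd, hd⟩
  · rintro ⟨hp, hpd, -⟩
    exact ⟨⟨(Nat.le_of_dvd (Nat.pos_of_ne_zero hd) hpd).trans_lt hN, hp⟩, hpd⟩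

/-- The primes below `N` dividing `d ≠ 0` are among the prime factors of `d`. [folklore] -/
theorem primesBelow_filter_dvd_subset {d : ℕ} (hd : d ≠ 0) (N : ℕ) :
    (Nat.primesBelow N).filter (· ∣ d) ⊆ d.primeFactors := by
  intro p hp
  rw [mem_filter, Nat.mem_primesBelow] at hp
  exact Nat.mem_primeFactors.2 ⟨hp.1.2, hp.2, hd⟩

/-- `M_d = (1 + T₀)^{ω(d)} B_h > 0`. [folklore] -/
theorem sigmaOneNormBoundCop_pos (d : ℕ) :
    0 < (1 + sigmaOneTailConst) ^ d.primeFactors.card * sigmaOneNormBound := by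
  have := sigmaOneTailConst_nonneg
  exact mul_pos (pow_pos (by linarith) _) sigmaOneNormBound_pos

/-! ### C. `h_d(n)/n` and the local factors of `L(h_d, ·)` at `s = 1` -/

/-- `h_d(0)/0 = 0`. [folklore] -/
theorem sigmaOneQuotCop_zero (a : ArithmeticFunction ℝ) : (a * normCountAF) 0 / ((0 : ℕ) : ℝ) = 0 := by simp

/-- `h_d(1)/1 = 1`. [folklore] -/
theorem sigmaOneQuotCop_one {d : ℕ} {a : ArithmeticFunction ℝ}
    (ha : ∀ n, a n = if Nat.Coprime d n then sigmaOneCoeff n else 0) :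
    (a * normCountAF) 1 / ((1 : ℕ) : ℝ) = 1 := by
  rw [sigmaOneNumCop_one ha, Nat.cast_one, div_one]

/-- `h_d(n)/n` is multiplicative on coprime arguments. [folklore] -/
theorem sigmaOneQuotCop_mul_of_coprime {d : ℕ} {a : ArithmeticFunction ℝ}
    (ha : ∀ n, a n = if Nat.Coprime d n then sigmaOneCoeff n else 0) {m n : ℕ} (hmn : m.Coprime n) :
    (a * normCountAF) (m * n) / ((m * n : ℕ) : ℝ) =
      (a * normCountAF) m / ((m : ℕ) : ℝ) * ((a * normCountAF) n / ((n : ℕ) : ℝ)) := by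
  rw [(isMultiplicative_sigmaOneNumCop ha).map_mul_of_coprime hmn, Nat.cast_mul, mul_div_mul_comm]

/-- The local factor of `L(h_d, ·)` at a prime `p ∣ d` is that of `ζ_K`:
`∑_e c_K(p^e)p^{-e} = (1 − normDensityAt p)⁻¹`. [folklore] -/
theorem tsum_sigmaOneQuotCop_prime_pow_of_dvd {d : ℕ} {a : ArithmeticFunction ℝ}
    (ha : ∀ n, a n = if Nat.Coprime d n then sigmaOneCoeff n else 0) {p : ℕ} (hp : p.Prime) (hpd : p ∣ d) :
    ∑' e : ℕ, (a * normCountAF) (p ^ e) / ((p ^ e : ℕ) : ℝ) = (1 - normDensityAt p)⁻¹ := by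
  refine ((hasSum_idealNormCount_prime_pow_div' hp).congr_fun fun e => ?_).tsum_eq
  rw [sigmaOneNumCop_prime_pow_of_dvd ha hp hpd, Nat.cast_pow]

/-- The local factor of `L(h_d, ·)` at a prime `p ∤ d` is the tree's
`(1 − ρ₀(p)/p)(1 − normDensityAt p)⁻¹`. [cite: HeathBrownActa2001, §10 p. 63] -/
theorem tsum_sigmaOneQuotCop_prime_pow_of_not_dvd {d : ℕ} {a : ArithmeticFunction ℝ}
    (ha : ∀ n, a n = if Nat.Coprime d n then sigmaOneCoeff n else 0) {p : ℕ} (hp : p.Prime) (hpd : ¬p ∣ d) :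
    ∑' e : ℕ, (a * normCountAF) (p ^ e) / ((p ^ e : ℕ) : ℝ) = (1 - densA p) * (1 - normDensityAt p)⁻¹ := by
  rw [← tsum_sigmaOneQuot_prime_pow hp]
  exact tsum_congr fun e => by
    rw [sigmaOneQuot_apply, sigmaOneNumCop_prime_pow_of_not_dvd ha hp hpd]

/-- `∏_{p<N}` of the local factors of `L(h_d, ·)` is `V_𝒜(N)/V_ℬ(N) · ∏_{p<N, p∣d}(1 − ν_p/(p+1))⁻¹`.
[cite: HeathBrownMoroz2004, §3 (3.1)] -/
theorem prod_tsum_sigmaOneQuotCop_eq {d : ℕ} {a : ArithmeticFunction ℝ}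
    (ha : ∀ n, a n = if Nat.Coprime d n then sigmaOneCoeff n else 0) (N : ℕ) :
    ∏ p ∈ Nat.primesBelow N, ∑' e : ℕ, (a * normCountAF) (p ^ e) / ((p ^ e : ℕ) : ℝ) =
      prodA N / prodB N * ∏ p ∈ (Nat.primesBelow N).filter (· ∣ d), (1 - densA p)⁻¹ := by
  rw [← prod_tsum_sigmaOneQuot_eq, prod_filter, ← prod_mul_distrib]
  refine prod_congr rfl fun p hp => ?_
  have hp' := (Nat.mem_primesBelow.1 hp).2
  by_cases hpd : p ∣ d
  · rw [if_pos hpd, tsum_sigmaOneQuotCop_prime_pow_of_dvd ha hp' hpd, tsum_sigmaOneQuot_prime_pow hp']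
    have h0 : 1 - densA p ≠ 0 := (one_sub_densA_pos_le hp').1.ne'
    rw [mul_assoc, mul_comm (1 - normDensityAt p)⁻¹, ← mul_assoc, mul_inv_cancel₀ h0, one_mul]
  · rw [if_neg hpd, mul_one, tsum_sigmaOneQuotCop_prime_pow_of_not_dvd ha hp' hpd,
      tsum_sigmaOneQuot_prime_pow hp']

/-- `coprimeClassWeight d = ∏_{p∣d}(1 − ν_p/(p+1))⁻¹`. [cite: HeathBrownMoroz2004, §3 (3.1)] -/
theorem coprimeClassWeight_eq_prod_inv (d : ℕ) :
    coprimeClassWeight d = ∏ p ∈ d.primeFactors, (1 - densA p)⁻¹ := by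
  rw [coprimeClassWeight]
  exact prod_congr rfl fun p hp => (inv_one_sub_densA_eq (Nat.prime_of_mem_primeFactors hp)).symm

/-- The finite Euler factor is eventually constant: `∏_{p<N, p∣d}(1 − ν_p/(p+1))⁻¹ → coprimeClassWeight d`
(`d ≠ 0`; equality for `N > d`). [folklore] -/
theorem tendsto_prod_filter_dvd {d : ℕ} (hd : d ≠ 0) :
    Tendsto (fun N : ℕ => ∏ p ∈ (Nat.primesBelow N).filter (· ∣ d), (1 - densA p)⁻¹) atTop
      (𝓝 (coprimeClassWeight d)) := by
  rw [coprimeClassWeight_eq_prod_inv]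
  refine tendsto_const_nhds.congr' ?_
  filter_upwards [eventually_gt_atTop d] with N hN
  rw [primesBelow_filter_dvd_eq hd hN]

end Summit.Parity.GeneralizedHardyLittlewood.Theorems.GoldbachHeathBrownDispersionHeathBrownMorozUniform

end
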